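import Summits.AtomisticToContinuum.HydrodynamicLimit.Theses.ImplosionDichotomy
import Summits.AtomisticToContinuum.HydrodynamicLimit.Theorems.ImplosionDichotomyTypeOneIdealImplosion

/-!
# `ImplosionDichotomy.IdealGasImplosion` from `TypeOneIdealImplosion` / from the BCG profile

Route `ImplosionDichotomy` of `AtomisticToContinuum/HydrodynamicLimit`. The support item
`TypeOneIdealImplosion` (stmt-AtomisticToContinuum-15146: a classical σ = 0 isentropic implosion on
`𝕋³` with smooth positive unit-mass data and the four rate clauses) implies the support item
`IdealGasImplosion` (stmt-AtomisticToContinuum-12588: continuous positive profiles, a classical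
σ = 0 solution with data `(a₀/∫a₀, u₀, θ₀)`, density unbounded on `[0, T₁)`) by forgetting the
isentropy, the Type-I, the derivative and the floor clauses and reading unboundedness off the
core-growth clause `c (T₁ − t)^{−β} ≤ ρ₁ t x`, `β, c > 0` (`(T₁ − t)^{−β} → ∞` as `t → T₁⁻`).

* `exists_time_core_ge` — the calculus step: for `β, c, T₁ > 0` and any `M` there is
  `t ∈ [0, T₁)` with `M ≤ c (T₁ − t)^{−β}`;
* `idealGasImplosion_of_typeOne` — the implication between the two item signatures (the signature
  of stmt-15146 verbatim as hypothesis; the route file renders no decl for it);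
* `idealGasImplosion_of_thm11` — hence `IdealGasImplosion` conditionally on the single named fact
  `Literature.Analysis.FluidPDE.BuckmasterCaolaboraGomezserrano2025_thm11_monatomic` (the `γ = 5/3`
  profile of Buckmaster–Cao-Labora–Gómez-Serrano, Thm 1.1), via `typeOneIdealImplosion_of_thm11`
  (`…Theorems.ImplosionDichotomyTypeOneIdealImplosion`). This replaces, for this item, the dropped
  route input `CaolaboraEtAl2025_thm12_euler (5/3)` of `idealGasImplosion_of_thm12` by the fact the
  route actually discharges; both items then close by one-line applications once its `_holds` lands.
-/

noncomputable section

namespace Summit.AtomisticToContinuum.HydrodynamicLimit.Theorems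

open Set MeasureTheory
open Literature.MathematicalPhysics.KineticTheory
open Literature.Analysis.FunctionSpaces

/-- For `β, c, T₁ > 0` and any level `M` there is a time `t ∈ [0, T₁)` at which
`M ≤ c (T₁ − t)^{−β}`: take `T₁ − t = min T₁ ((max M c / c)^{−1/β})`. [folklore] -/
theorem exists_time_core_ge {β c T₁ : ℝ} (hβ : 0 < β) (hc : 0 < c) (hT₁ : 0 < T₁) (M : ℝ) :
    ∃ t ∈ Ico 0 T₁, M ≤ c * (T₁ - t) ^ (-β) := by
  set M' : ℝ := max M c with hM'
  have hM'c : c ≤ M' := le_max_right _ _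
  have hM'pos : 0 < M' := hc.trans_le hM'c
  have hq : 1 ≤ M' / c := by rwa [le_div_iff₀ hc, one_mul]
  have hqpos : 0 < M' / c := one_pos.trans_le hq
  set d : ℝ := min T₁ ((M' / c) ^ (-(1 / β))) with hd
  have hdpos : 0 < d := lt_min hT₁ (Real.rpow_pos_of_pos hqpos _)
  have hdT : d ≤ T₁ := min_le_left _ _
  have hdle : d ≤ (M' / c) ^ (-(1 / β)) := min_le_right _ _
  refine ⟨T₁ - d, ⟨by linarith, by linarith⟩, ?_⟩
  have hTt : T₁ - (T₁ - d) = d := by ring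
  rw [hTt]
  -- `d ^ (-β) ≥ ((M'/c) ^ (-(1/β))) ^ (-β) = M'/c`
  have hanti : ((M' / c) ^ (-(1 / β))) ^ (-β) ≤ d ^ (-β) :=
    Real.rpow_le_rpow_of_nonpos hdpos hdle (by linarith)
  have hid : ((M' / c) ^ (-(1 / β))) ^ (-β) = M' / c := by
    rw [← Real.rpow_mul hqpos.le, show -(1 / β) * -β = 1 by field_simp, Real.rpow_one]
  rw [hid] at hanti
  calc M ≤ M' := le_max_left _ _
    _ = c * (M' / c) := by field_simp
    _ ≤ c * d ^ (-β) := mul_le_mul_of_nonneg_left hanti hc.le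

/-- **`TypeOneIdealImplosion` ⟹ `IdealGasImplosion`** (stmt-AtomisticToContinuum-15146 ⟹
stmt-AtomisticToContinuum-12588): forget isentropy and the rate clauses except core growth, which
gives unbounded density by `exists_time_core_ge`; smooth profiles are continuous. The hypothesis is
the ledger signature of stmt-15146 verbatim. [cite: CaolaboraEtAl2025, Thm 1.2 + Rem 1.4 + Rem 1.5] -/
theorem idealGasImplosion_of_typeOne
    (h : ∃ (a₀ θ₀ : Literature.MathematicalPhysics.KineticTheory.T3 → ℝ)
      (u₀ : Literature.MathematicalPhysics.KineticTheory.T3 → Literature.MathematicalPhysics.KineticTheory.V3),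
      Literature.Analysis.FunctionSpaces.Torus.IsSmooth a₀ ∧
      Literature.Analysis.FunctionSpaces.Torus.IsSmooth θ₀ ∧
      Literature.Analysis.FunctionSpaces.Torus.IsSmooth u₀ ∧ (∀ x, 0 < a₀ x) ∧ (∀ x, 0 < θ₀ x) ∧
      ∃ (T₁ K : ℝ) (ρ₁ θ₁ : ℝ → Literature.MathematicalPhysics.KineticTheory.T3 → ℝ)
        (u₁ : ℝ → Literature.MathematicalPhysics.KineticTheory.T3 →
          Literature.MathematicalPhysics.KineticTheory.V3), 0 < T₁ ∧ 0 < K ∧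
        Literature.MathematicalPhysics.KineticTheory.IsHardSphereEulerSolution 0 T₁ ρ₁ u₁ θ₁ ∧
        (∀ x, ρ₁ 0 x = a₀ x / ∫ y, a₀ y) ∧ u₁ 0 = u₀ ∧ θ₁ 0 = θ₀ ∧
        (∀ t ∈ Set.Ico 0 T₁, ∀ x, θ₁ t x = K * ρ₁ t x ^ (2 / 3 : ℝ)) ∧
        (∃ C : ℝ, ∀ t ∈ Set.Ico 0 T₁, ∀ x, ∀ i : Fin 3,
          ‖Literature.Analysis.FunctionSpaces.Torus.partialDeriv i (u₁ t) x‖ ≤ C / (T₁ - t) ∧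
          |Literature.Analysis.FunctionSpaces.Torus.partialDeriv i
              (fun y => ρ₁ t y ^ (1 / 3 : ℝ)) x| ≤ C / (T₁ - t)) ∧
        (∀ n : ℕ, n ≤ 6 → ∃ Cn pn : ℝ, ∀ t ∈ Set.Ico 0 T₁, ∀ y : EuclideanSpace ℝ (Fin 3),
          ‖iteratedFDeriv ℝ n (Literature.Analysis.FunctionSpaces.Torus.lift (ρ₁ t)) y‖ ≤
              Cn * (T₁ - t) ^ (-pn) ∧
          ‖iteratedFDeriv ℝ n (Literature.Analysis.FunctionSpaces.Torus.lift (u₁ t)) y‖ ≤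
              Cn * (T₁ - t) ^ (-pn)) ∧
        (∃ cl pl : ℝ, 0 < cl ∧ ∀ t ∈ Set.Ico 0 T₁, ∀ x, cl * (T₁ - t) ^ pl ≤ ρ₁ t x) ∧
        ∃ β c : ℝ, 0 < β ∧ 0 < c ∧ ∀ t ∈ Set.Ico 0 T₁, ∃ x, c * (T₁ - t) ^ (-β) ≤ ρ₁ t x) :
    Summit.AtomisticToContinuum.HydrodynamicLimit.Theses.ImplosionDichotomy.IdealGasImplosion := by
  unfold Summit.AtomisticToContinuum.HydrodynamicLimit.Theses.ImplosionDichotomy.IdealGasImplosion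
  obtain ⟨a₀, θ₀, u₀, ha, hθ, hu, hapos, hθpos, T₁, K, ρ₁, θ₁, u₁, hT₁, -, hsol, hρ0, hu0, hθ0, -,
    -, -, -, β, c, hβ, hc, hcore⟩ := h
  refine ⟨a₀, θ₀, u₀, ha.continuous, hθ.continuous, hu.continuous, hapos, hθpos, T₁, ρ₁, θ₁, u₁,
    hT₁, hsol, hρ0, hu0, hθ0, fun M => ?_⟩
  obtain ⟨t, ht, hM⟩ := exists_time_core_ge hβ hc hT₁ M
  obtain ⟨x, hx⟩ := hcore t ht
  exact ⟨t, ht, x, hM.trans hx⟩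

/-- **`IdealGasImplosion` (stmt-AtomisticToContinuum-12588) conditionally on the BCG profile
alone**: `idealGasImplosion_of_typeOne ∘ typeOneIdealImplosion_of_thm11`.
[cite: CaolaboraEtAl2025, Thm 1.2 + Rem 1.4 + Rem 1.5] [cite: BuckmasterCaolaboraGomezserrano2025, Thm 1.1]
[cite: Majda1984, Ch. 2 Thm 2.1] -/
theorem idealGasImplosion_of_thm11
    (hBCG : Literature.Analysis.FluidPDE.BuckmasterCaolaboraGomezserrano2025_thm11_monatomic) :
    Summit.AtomisticToContinuum.HydrodynamicLimit.Theses.ImplosionDichotomy.IdealGasImplosion :=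
  idealGasImplosion_of_typeOne (typeOneIdealImplosion_of_thm11 hBCG)

end Summit.AtomisticToContinuum.HydrodynamicLimit.Theorems

end
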